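import Summits.HodgeConjecture.HodgeConjecture.Theorems.Ring2WeilCoverageCMFieldAllPrimesS
import HarnessLib

/-!
# Weil-type components over quartic CM fields, IX (part T): every prime of `ℤ[σ] = ℤ[√2]` split in
# `E = ℚ(√-(3+√2))` carries an integral norm `π·μ = Nm(z)` with `μ` totally positive of 2-power norm

research route conditional on HC_CM; not a corollary; Q11.4-sentence-2 already refuted in dim ≥ 3. Cell
`pub-hodge-ring2`, seat `ring2-b03` (gen 53); `HOME/WEIL-FAMILY-COVERAGE.md` §b03.5, seventh table
(`E = F(η)`, `η² = σ = -3-√2`, `F = ℚ(√2)`, `R = S² + 6S + 7`); coordinates as in parts P–S. The outer induction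
closing the descent: by strong induction on the norm, every SPLIT-type prime element `π` of `ℤ[σ]` — a totally
positive degree-one `π = u + vσ` of prime norm `ℓ` with `σ ≡ -t` a square mod `ℓ`, or an inert rational prime
`q` (`2` a non-square) with `7` a square mod `q` — satisfies
**`P⁺(π)`: `Nm(z) = π·μ` for an integral `z ∈ ℤ[η]` and a totally positive `μ ∈ ℤ[σ]` with `N(μ) = 2^e`.**
Large norm (`ℓ ≥ 182`, `q ≥ 19`): part S's box gives `π·μ₀ = Nm(z)` with `N(μ₀) < 182 < N(π)`, and part R's
descent removes the odd primes of `μ₀` using `P⁺` for the smaller split-type primes (induction hypothesis).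
Small norm: an explicit table — the 20 split-type degree-one places of norm `< 182` (over
`ℓ = 7, 17, 23, 31, 41, 47, 71, 73, 79, 89, 97, 127, 137, 151`; at `103, 113, 167` and at the other places the
image of `σ` is a non-square, decided by `decide`) with one generator and one witness each, transported to an
arbitrary totally positive generator of the same place by Pell (part P: the quotient is a totally positive unit,
hence a square); and `q = 3` (`3·(2+√2) = Nm(1+√2+η)`).

* §1 transport of a witness along a place (`witness_transfer`), `2` is a square mod the norm of a degree-one prime;
* §2 the table (`base_degOne_witness`);
* (part U, §0) **`splitType_witness`**: `P⁺` for every split-type prime element, both kinds — the induction itself.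

No named fact, no definition, no `sorry`; nothing about the Hodge conjecture is asserted.
References: [Deligne1982HodgeCycles] §4 p. 30 (1), Cor. 4.2; [Landherr1936HermitianForms]. -/

noncomputable section

set_option linter.dupNamespace false

open Polynomial

namespace Summit.HodgeConjecture.HodgeConjecture.Ring2.WeilCoverageCM

/-! ### §1 Transport along a place -/

/-- `t' ≡ r (mod ℓ)` ⟹ `ℓ ∣ u' - r·v'` for a degree-one `π' = u' + v'σ` with data `t'` (`u' - t'v' = ℓg₁`). [folklore] -/
theorem dvd_of_residue {u' v' g₀ g₁ t' : ℤ} {ℓ : ℕ} (hN : u' ^ 2 - 6 * u' * v' + 7 * v' ^ 2 = ℓ)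
    (ht : u' * g₀ - 7 * v' * g₁ = t') (hγ : v' * g₀ + u' * g₁ - 6 * v' * g₁ = 1) (r : ℤ)
    (hr : (t' : ZMod ℓ) = (r : ZMod ℓ)) : (ℓ : ℤ) ∣ u' - r * v' := by
  have h1 := congrArg (Int.cast : ℤ → ZMod ℓ) (degOne_u_sub_tv hN ht hγ)
  rw [← ZMod.intCast_zmod_eq_zero_iff_dvd]
  push_cast at h1 ⊢
  rw [← hr, h1, ZMod.natCast_self, zero_mul]

/-- **Transport of a witness along a place.** `θ₀ = u₀ + v₀σ` totally positive of prime norm `ℓ` with data `t₀`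
and an integral witness `Nm(w) = θ₀·μ_w` (`μ_w` totally positive, `N(μ_w) = 2^e`); `θ' = u' + v'σ` totally positive
of the same norm with `ℓ ∣ u' - t₀v'` (the same place). Then `θ' = θ₀·ω`, `ω` a totally positive unit, `ω = κ²`
by Pell, and `Nm(κ·w) = θ'·μ_w`. [folklore] -/
theorem witness_transfer {u₀ v₀ g₀ g₁ t₀ : ℤ} {ℓ : ℕ} (hℓ : ℓ.Prime)
    (hN₀ : u₀ ^ 2 - 6 * u₀ * v₀ + 7 * v₀ ^ 2 = ℓ) (ht₀ : u₀ * g₀ - 7 * v₀ * g₁ = t₀)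
    (hγ₀ : v₀ * g₀ + u₀ * g₁ - 6 * v₀ * g₁ = 1) (hpos₀ : 0 < u₀ - 3 * v₀)
    {a₀ a₁ b₀ b₁ m₀ m₁ : ℤ} {e : ℕ}
    (hXw : a₀ ^ 2 - 7 * a₁ ^ 2 + 14 * b₀ * b₁ - 42 * b₁ ^ 2 = u₀ * m₀ - 7 * v₀ * m₁)
    (hYw : 2 * a₀ * a₁ - 6 * a₁ ^ 2 - b₀ ^ 2 + 12 * b₀ * b₁ - 29 * b₁ ^ 2 = u₀ * m₁ + v₀ * m₀ - 6 * v₀ * m₁)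
    (hposw : 0 < m₀ - 3 * m₁) (hNw : m₀ ^ 2 - 6 * m₀ * m₁ + 7 * m₁ ^ 2 = 2 ^ e)
    {u' v' : ℤ} (hN' : u' ^ 2 - 6 * u' * v' + 7 * v' ^ 2 = ℓ) (hpos' : 0 < u' - 3 * v')
    (hdvd : (ℓ : ℤ) ∣ u' - t₀ * v') :
    ∃ a₀' a₁' b₀' b₁' m₀' m₁' : ℤ, ∃ e' : ℕ,
      a₀' ^ 2 - 7 * a₁' ^ 2 + 14 * b₀' * b₁' - 42 * b₁' ^ 2 = u' * m₀' - 7 * v' * m₁' ∧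
      2 * a₀' * a₁' - 6 * a₁' ^ 2 - b₀' ^ 2 + 12 * b₀' * b₁' - 29 * b₁' ^ 2 = u' * m₁' + v' * m₀' - 6 * v' * m₁' ∧
      0 < m₀' - 3 * m₁' ∧ m₀' ^ 2 - 6 * m₀' * m₁' + 7 * m₁' ^ 2 = 2 ^ e' := by
  have hℓ0 : (0 : ℤ) < ℓ := by exact_mod_cast hℓ.pos
  obtain ⟨c, d, hc, hd⟩ := (degOne_dvd_iff hN₀ ht₀ hγ₀ u' v').2 hdvd
  -- `ω = (c, d)` is a totally positive unit, hence a square `κ² = (w₀ + w₁σ)²`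
  subst hc hd
  have hNω : c ^ 2 - 6 * c * d + 7 * d ^ 2 = 1 := by
    have h1 : (ℓ : ℤ) * (c ^ 2 - 6 * c * d + 7 * d ^ 2) = ℓ * 1 := by
      have h2 := hN'
      rw [zs_norm_mul, hN₀] at h2
      rw [h2, mul_one]
    exact mul_left_cancel₀ hℓ0.ne' h1
  have hposω := totPos_cancel hpos₀ (by rw [hN₀]; exact hℓ0) hpos' (by rw [hN']; exact hℓ0)
  obtain ⟨w₀, w₁, hc, hd, -⟩ := totPos_unit_sq hposω.1 hNω
  -- `Nm(κ·w) = κ²·Nm(w) = κ²·θ₀·μ_w = θ'·μ_w`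
  obtain ⟨h1, h2⟩ := nm_smul w₀ w₁ a₀ a₁ b₀ b₁
  rw [hXw, hYw] at h1 h2
  refine ⟨w₀ * a₀ - 7 * w₁ * a₁, w₀ * a₁ + w₁ * a₀ - 6 * w₁ * a₁, w₀ * b₀ - 7 * w₁ * b₁,
    w₀ * b₁ + w₁ * b₀ - 6 * w₁ * b₁, m₀, m₁, e, ?_, ?_, hposw, hNw⟩
  · rw [h1, hc, hd]; ring
  · rw [h2, hc, hd]; ring

/-- **`2` is a square mod the norm `ℓ ≠ 2` of a degree-one element** (`ℓ = (u - 3v)² - 2v²`, `ℓ ∤ v`). [folklore] -/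
theorem isSquare_two_of_norm_eq {u v : ℤ} {ℓ : ℕ} (hℓ : ℓ.Prime) (hN : u ^ 2 - 6 * u * v + 7 * v ^ 2 = ℓ) :
    IsSquare (2 : ZMod ℓ) := by
  haveI : Fact ℓ.Prime := ⟨hℓ⟩
  have hℓp : Prime (ℓ : ℤ) := Nat.prime_iff_prime_int.1 hℓ
  have hv : (v : ZMod ℓ) ≠ 0 := by
    intro h
    rw [ZMod.intCast_zmod_eq_zero_iff_dvd] at h
    obtain ⟨k, hk⟩ := h
    have h1 : (ℓ : ℤ) ∣ (u - 3 * v) ^ 2 := ⟨1 + 2 * ℓ * k ^ 2, by rw [hk]; rw [hk] at hN; linear_combination hN⟩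
    obtain ⟨j, hj⟩ := hℓp.dvd_of_dvd_pow h1
    have e1 : (ℓ : ℤ) * (ℓ * (j ^ 2 - 2 * k ^ 2) - 1) = 0 := by
      have : (u - 3 * v) ^ 2 - 2 * v ^ 2 = ℓ := by linear_combination hN
      rw [hj, hk] at this
      linear_combination this
    have e2 : (ℓ : ℤ) * (j ^ 2 - 2 * k ^ 2) - 1 = 0 := (mul_eq_zero.1 e1).resolve_left hℓp.ne_zero
    have h3 : (ℓ : ℤ) ∣ 1 := ⟨j ^ 2 - 2 * k ^ 2, by linear_combination -e2⟩
    exact hℓ.not_dvd_one (by exact_mod_cast h3)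
  refine ⟨((u : ZMod ℓ) - 3 * v) / v, ?_⟩
  field_simp
  have := congrArg (Int.cast : ℤ → ZMod ℓ) hN
  push_cast at this
  rw [ZMod.natCast_self] at this
  linear_combination -this

/-! ### §2 The table: split-type degree-one places of norm `< 182` -/

/-- The residues `ℓ ≡ ±1 (mod 8)` below `182`, listed (primes first). [folklore] -/
theorem cases_mod_eight_lt_182 (ℓ : ℕ) (hle : ℓ < 182) (h8 : ℓ % 8 = 1 ∨ ℓ % 8 = 7) :
    ℓ = 7 ∨ ℓ = 17 ∨ ℓ = 23 ∨ ℓ = 31 ∨ ℓ = 41 ∨ ℓ = 47 ∨ ℓ = 71 ∨ ℓ = 73 ∨ ℓ = 79 ∨ ℓ = 89 ∨ ℓ = 97 ∨ ℓ = 103 ∨ ℓ = 113 ∨ ℓ = 127 ∨ ℓ = 137 ∨ ℓ = 151 ∨ ℓ = 167 ∨ (ℓ = 1 ∨ ℓ = 9 ∨ ℓ = 15 ∨ ℓ = 25 ∨ ℓ = 33 ∨ ℓ = 39 ∨ ℓ = 49 ∨ ℓ = 55 ∨ ℓ = 57 ∨ ℓ = 63 ∨ ℓ = 65 ∨ ℓ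 = 81 ∨ ℓ = 87 ∨ ℓ = 95 ∨ ℓ = 105 ∨ ℓ = 111 ∨ ℓ = 119 ∨ ℓ = 121 ∨ ℓ = 129 ∨ ℓ = 135 ∨ ℓ = 143 ∨ ℓ = 145 ∨ ℓ = 153 ∨ ℓ = 159 ∨ ℓ = 161 ∨ ℓ = 169 ∨ ℓ = 175 ∨ ℓ = 177) := by
  interval_cases ℓ <;> first | (exfalso; omega) | decide

set_option maxRecDepth 20000 in
/-- **Base of the induction**: `P⁺(θ')` for every totally positive degree-one `θ' = u' + v'σ` of prime norm
`ℓ < 182` (`ℓ ≠ 2`) with Bezout data `t'` and `-t'` a square mod `ℓ` — one tabulated generator and witness per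
split-type place, transported by `witness_transfer`; the places with `-t'` a non-square are excluded by `decide`.
[folklore] -/
theorem base_degOne_witness (u' v' g₀ g₁ t' : ℤ) (ℓ : ℕ) (hℓ : ℓ.Prime) (hℓ2 : ℓ ≠ 2) (hle : ℓ < 182)
    (hN : u' ^ 2 - 6 * u' * v' + 7 * v' ^ 2 = ℓ) (ht : u' * g₀ - 7 * v' * g₁ = t')
    (hγ : v' * g₀ + u' * g₁ - 6 * v' * g₁ = 1) (hpos : 0 < u' - 3 * v') (hsq : IsSquare (-(t' : ZMod ℓ))) :
    ∃ a₀ a₁ b₀ b₁ m₀ m₁ : ℤ, ∃ e : ℕ,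
      a₀ ^ 2 - 7 * a₁ ^ 2 + 14 * b₀ * b₁ - 42 * b₁ ^ 2 = u' * m₀ - 7 * v' * m₁ ∧
      2 * a₀ * a₁ - 6 * a₁ ^ 2 - b₀ ^ 2 + 12 * b₀ * b₁ - 29 * b₁ ^ 2 = u' * m₁ + v' * m₀ - 6 * v' * m₁ ∧
      0 < m₀ - 3 * m₁ ∧ m₀ ^ 2 - 6 * m₀ * m₁ + 7 * m₁ ^ 2 = 2 ^ e := by
  have h8 : ℓ % 8 = 1 ∨ ℓ % 8 = 7 := by
    haveI : Fact ℓ.Prime := ⟨hℓ⟩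
    exact (ZMod.exists_sq_eq_two_iff hℓ2).1 (isSquare_two_of_norm_eq hℓ hN)
  have hroot := degOne_root hN ht hγ
  have hcases : ℓ = 7 ∨ ℓ = 17 ∨ ℓ = 23 ∨ ℓ = 31 ∨ ℓ = 41 ∨ ℓ = 47 ∨ ℓ = 71 ∨ ℓ = 73 ∨ ℓ = 79 ∨ ℓ = 89 ∨ ℓ = 97 ∨ ℓ = 103 ∨ ℓ = 113 ∨ ℓ = 127 ∨ ℓ = 137 ∨ ℓ = 151 ∨ ℓ = 167 ∨ (ℓ = 1 ∨ ℓ = 9 ∨ ℓ = 15 ∨ ℓ = 25 ∨ ℓ = 33 ∨ ℓ = 39 ∨ ℓ = 49 ∨ ℓ = 55 ∨ ℓ = 57 ∨ ℓ = 63 ∨ ℓ = 65 ∨ ℓ = 81 ∨ ℓ = 87 ∨ ℓ = 95 ∨ ℓ = 105 ∨ ℓ = 111 ∨ ℓ = 119 ∨ ℓ = 121 ∨ ℓ = 129 ∨ ℓ = 135 ∨ ℓ = 143 ∨ ℓ = 145 ∨ ℓ = 153 ∨ ℓ = 159 ∨ ℓ = 161 ∨ ℓ = 169 ∨ ℓ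 = 175 ∨ ℓ = 177) := cases_mod_eight_lt_182 ℓ hle h8
  rcases hcases with h | h | h | h | h | h | h | h | h | h | h | h | h | h | h | h | h | h
  · -- ℓ = 7: roots 0, 6 of T² - 6T + 7
    subst h
    have hr1 : (0 : ZMod 7) + 6 = 6 := by decide
    have hr2 : (0 : ZMod 7) * 6 = 7 := by decide
    haveI : Fact (Nat.Prime 7) := ⟨hℓ⟩
    have hfac : ((t' : ZMod 7) - 0) * ((t' : ZMod 7) - 6) = 0 := by
      linear_combination hroot - (t' : ZMod 7) * hr1 + hr2
    rcases mul_eq_zero.1 hfac with h1 | h1 <;> replace h1 := sub_eq_zero.1 h1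
    · exact witness_transfer (u₀ := 0) (v₀ := -1) (g₀ := -1) (g₁ := 0) (t₀ := 0) hℓ (by norm_num)
        (by norm_num) (by norm_num) (by norm_num) (a₀ := 0) (a₁ := 0) (b₀ := 1) (b₁ := 0) (m₀ := 1) (m₁ := 0)
        (e := 0) (by norm_num) (by norm_num) (by norm_num) (by norm_num) hN hpos
        (dvd_of_residue hN ht hγ 0 (by rw [h1]; norm_num))
    · exact witness_transfer (u₀ := 40) (v₀ := 9) (g₀ := -3) (g₁ := -2) (t₀ := 6) hℓ (by norm_num)
        (by norm_num) (by norm_num) (by norm_num) (a₀ := -1) (a₁ := 0) (b₀ := 1) (b₁ := 0) (m₀ := -11) (m₁ := -7)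
        (e := 1) (by norm_num) (by norm_num) (by norm_num) (by norm_num) hN hpos
        (dvd_of_residue hN ht hγ 6 (by rw [h1]; norm_num))
  · -- ℓ = 17: roots 9, 14 of T² - 6T + 7
    subst h
    have hr1 : (9 : ZMod 17) + 14 = 6 := by decide
    have hr2 : (9 : ZMod 17) * 14 = 7 := by decide
    have hns14 : ¬ IsSquare (-(14 : ZMod 17)) := by decide
    haveI : Fact (Nat.Prime 17) := ⟨hℓ⟩
    have hfac : ((t' : ZMod 17) - 9) * ((t' : ZMod 17) - 14) = 0 := by
      linear_combination hroot - (t' : ZMod 17) * hr1 + hr2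
    rcases mul_eq_zero.1 hfac with h1 | h1 <;> replace h1 := sub_eq_zero.1 h1
    · exact witness_transfer (u₀ := 115) (v₀ := 26) (g₀ := -11) (g₁ := -7) (t₀ := 9) hℓ (by norm_num)
        (by norm_num) (by norm_num) (by norm_num) (a₀ := -1) (a₁ := 0) (b₀ := 2) (b₁ := 1) (m₀ := -65) (m₁ := -41)
        (e := 1) (by norm_num) (by norm_num) (by norm_num) (by norm_num) hN hpos
        (dvd_of_residue hN ht hγ 9 (by rw [h1]; norm_num))
    · -- t' ≡ 14: -14 is a non-square mod 17 (that place is inert in E/F)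
      rw [h1] at hsq; exact absurd hsq hns14
  · -- ℓ = 23: roots 8, 21 of T² - 6T + 7
    subst h
    have hr1 : (8 : ZMod 23) + 21 = 6 := by decide
    have hr2 : (8 : ZMod 23) * 21 = 7 := by decide
    have hns8 : ¬ IsSquare (-(8 : ZMod 23)) := by decide
    haveI : Fact (Nat.Prime 23) := ⟨hℓ⟩
    have hfac : ((t' : ZMod 23) - 8) * ((t' : ZMod 23) - 21) = 0 := by
      linear_combination hroot - (t' : ZMod 23) * hr1 + hr2
    rcases mul_eq_zero.1 hfac with h1 | h1 <;> replace h1 := sub_eq_zero.1 h1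
    · -- t' ≡ 8: -8 is a non-square mod 23 (that place is inert in E/F)
      rw [h1] at hsq; exact absurd hsq hns8
    · exact witness_transfer (u₀ := 32) (v₀ := 7) (g₀ := -7) (g₁ := -5) (t₀ := 21) hℓ (by norm_num)
        (by norm_num) (by norm_num) (by norm_num) (a₀ := -3) (a₁ := -1) (b₀ := 1) (b₁ := 0) (m₀ := -3) (m₁ := -2)
        (e := 0) (by norm_num) (by norm_num) (by norm_num) (by norm_num) hN hpos
        (dvd_of_residue hN ht hγ 21 (by rw [h1]; norm_num))
  · -- ℓ = 31: roots 11, 26 of T² - 6T + 7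
    subst h
    have hr1 : (11 : ZMod 31) + 26 = 6 := by decide
    have hr2 : (11 : ZMod 31) * 26 = 7 := by decide
    haveI : Fact (Nat.Prime 31) := ⟨hℓ⟩
    have hfac : ((t' : ZMod 31) - 11) * ((t' : ZMod 31) - 26) = 0 := by
      linear_combination hroot - (t' : ZMod 31) * hr1 + hr2
    rcases mul_eq_zero.1 hfac with h1 | h1 <;> replace h1 := sub_eq_zero.1 h1
    · exact witness_transfer (u₀ := 146) (v₀ := 33) (g₀ := -11) (g₁ := -7) (t₀ := 11) hℓ (by norm_num)
        (by norm_num) (by norm_num) (by norm_num) (a₀ := -3) (a₁ := -2) (b₀ := 1) (b₁ := 0) (m₀ := -65) (m₁ := -41)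
        (e := 1) (by norm_num) (by norm_num) (by norm_num) (by norm_num) hN hpos
        (dvd_of_residue hN ht hγ 11 (by rw [h1]; norm_num))
    · exact witness_transfer (u₀ := 102) (v₀ := 23) (g₀ := -25) (g₁ := -16) (t₀ := 26) hℓ (by norm_num)
        (by norm_num) (by norm_num) (by norm_num) (a₀ := -1) (a₁ := -1) (b₀ := 1) (b₁ := 0) (m₀ := -19) (m₁ := -12)
        (e := 0) (by norm_num) (by norm_num) (by norm_num) (by norm_num) hN hpos
        (dvd_of_residue hN ht hγ 26 (by rw [h1]; norm_num))
  · -- ℓ = 41: roots 20, 27 of T² - 6T + 7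
    subst h
    have hr1 : (20 : ZMod 41) + 27 = 6 := by decide
    have hr2 : (20 : ZMod 41) * 27 = 7 := by decide
    have hns27 : ¬ IsSquare (-(27 : ZMod 41)) := by decide
    haveI : Fact (Nat.Prime 41) := ⟨hℓ⟩
    have hfac : ((t' : ZMod 41) - 20) * ((t' : ZMod 41) - 27) = 0 := by
      linear_combination hroot - (t' : ZMod 41) * hr1 + hr2
    rcases mul_eq_zero.1 hfac with h1 | h1 <;> replace h1 := sub_eq_zero.1 h1
    · exact witness_transfer (u₀ := 37) (v₀ := 8) (g₀ := -4) (g₁ := -3) (t₀ := 20) hℓ (by norm_num)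
        (by norm_num) (by norm_num) (by norm_num) (a₀ := -2) (a₁ := -1) (b₀ := 1) (b₁ := 1) (m₀ := -19) (m₁ := -12)
        (e := 0) (by norm_num) (by norm_num) (by norm_num) (by norm_num) hN hpos
        (dvd_of_residue hN ht hγ 20 (by rw [h1]; norm_num))
    · -- t' ≡ 27: -27 is a non-square mod 41 (that place is inert in E/F)
      rw [h1] at hsq; exact absurd hsq hns27
  · -- ℓ = 47: roots 10, 43 of T² - 6T + 7
    subst h
    have hr1 : (10 : ZMod 47) + 43 = 6 := by decide
    have hr2 : (10 : ZMod 47) * 43 = 7 := by decide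
    haveI : Fact (Nat.Prime 47) := ⟨hℓ⟩
    have hfac : ((t' : ZMod 47) - 10) * ((t' : ZMod 47) - 43) = 0 := by
      linear_combination hroot - (t' : ZMod 47) * hr1 + hr2
    rcases mul_eq_zero.1 hfac with h1 | h1 <;> replace h1 := sub_eq_zero.1 h1
    · exact witness_transfer (u₀ := 76) (v₀ := 17) (g₀ := -3) (g₁ := -2) (t₀ := 10) hℓ (by norm_num)
        (by norm_num) (by norm_num) (by norm_num) (a₀ := -5) (a₁ := -2) (b₀ := 1) (b₁ := 0) (m₀ := -11) (m₁ := -7)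
        (e := 1) (by norm_num) (by norm_num) (by norm_num) (by norm_num) hN hpos
        (dvd_of_residue hN ht hγ 10 (by rw [h1]; norm_num))
    · exact witness_transfer (u₀ := 50) (v₀ := 11) (g₀ := -13) (g₁ := -9) (t₀ := 43) hℓ (by norm_num)
        (by norm_num) (by norm_num) (by norm_num) (a₀ := -2) (a₁ := 0) (b₀ := 1) (b₁ := 0) (m₀ := -3) (m₁ := -2)
        (e := 0) (by norm_num) (by norm_num) (by norm_num) (by norm_num) hN hpos
        (dvd_of_residue hN ht hγ 43 (by rw [h1]; norm_num))
  · -- ℓ = 71: roots 15, 62 of T² - 6T + 7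
    subst h
    have hr1 : (15 : ZMod 71) + 62 = 6 := by decide
    have hr2 : (15 : ZMod 71) * 62 = 7 := by decide
    have hns15 : ¬ IsSquare (-(15 : ZMod 71)) := by decide
    haveI : Fact (Nat.Prime 71) := ⟨hℓ⟩
    have hfac : ((t' : ZMod 71) - 15) * ((t' : ZMod 71) - 62) = 0 := by
      linear_combination hroot - (t' : ZMod 71) * hr1 + hr2
    rcases mul_eq_zero.1 hfac with h1 | h1 <;> replace h1 := sub_eq_zero.1 h1
    · -- t' ≡ 15: -15 is a non-square mod 71 (that place is inert in E/F)
      rw [h1] at hsq; exact absurd hsq hns15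
    · exact witness_transfer (u₀ := 164) (v₀ := 37) (g₀ := -47) (g₁ := -30) (t₀ := 62) hℓ (by norm_num)
        (by norm_num) (by norm_num) (by norm_num) (a₀ := -3) (a₁ := 0) (b₀ := 1) (b₁ := 0) (m₀ := -11) (m₁ := -7)
        (e := 1) (by norm_num) (by norm_num) (by norm_num) (by norm_num) hN hpos
        (dvd_of_residue hN ht hγ 62 (by rw [h1]; norm_num))
  · -- ℓ = 73: roots 35, 44 of T² - 6T + 7
    subst h
    have hr1 : (35 : ZMod 73) + 44 = 6 := by decide
    have hr2 : (35 : ZMod 73) * 44 = 7 := by decide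
    have hns44 : ¬ IsSquare (-(44 : ZMod 73)) := by decide
    haveI : Fact (Nat.Prime 73) := ⟨hℓ⟩
    have hfac : ((t' : ZMod 73) - 35) * ((t' : ZMod 73) - 44) = 0 := by
      linear_combination hroot - (t' : ZMod 73) * hr1 + hr2
    rcases mul_eq_zero.1 hfac with h1 | h1 <;> replace h1 := sub_eq_zero.1 h1
    · exact witness_transfer (u₀ := 55) (v₀ := 12) (g₀ := -7) (g₁ := -5) (t₀ := 35) hℓ (by norm_num)
        (by norm_num) (by norm_num) (by norm_num) (a₀ := -1) (a₁ := 1) (b₀ := 1) (b₁ := 1) (m₀ := -22) (m₁ := -14)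
        (e := 3) (by norm_num) (by norm_num) (by norm_num) (by norm_num) hN hpos
        (dvd_of_residue hN ht hγ 35 (by rw [h1]; norm_num))
    · -- t' ≡ 44: -44 is a non-square mod 73 (that place is inert in E/F)
      rw [h1] at hsq; exact absurd hsq hns44
  · -- ℓ = 79: roots 12, 73 of T² - 6T + 7
    subst h
    have hr1 : (12 : ZMod 79) + 73 = 6 := by decide
    have hr2 : (12 : ZMod 79) * 73 = 7 := by decide
    have hns73 : ¬ IsSquare (-(73 : ZMod 79)) := by decide
    haveI : Fact (Nat.Prime 79) := ⟨hℓ⟩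
    have hfac : ((t' : ZMod 79) - 12) * ((t' : ZMod 79) - 73) = 0 := by
      linear_combination hroot - (t' : ZMod 79) * hr1 + hr2
    rcases mul_eq_zero.1 hfac with h1 | h1 <;> replace h1 := sub_eq_zero.1 h1
    · exact witness_transfer (u₀ := 94) (v₀ := 21) (g₀ := -3) (g₁ := -2) (t₀ := 12) hℓ (by norm_num)
        (by norm_num) (by norm_num) (by norm_num) (a₀ := -1) (a₁ := 0) (b₀ := 3) (b₁ := 2) (m₀ := -65) (m₁ := -41)
        (e := 1) (by norm_num) (by norm_num) (by norm_num) (by norm_num) hN hpos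
        (dvd_of_residue hN ht hγ 12 (by rw [h1]; norm_num))
    · -- t' ≡ 73: -73 is a non-square mod 79 (that place is inert in E/F)
      rw [h1] at hsq; exact absurd hsq hns73
  · -- ℓ = 89: roots 28, 67 of T² - 6T + 7
    subst h
    have hr1 : (28 : ZMod 89) + 67 = 6 := by decide
    have hr2 : (28 : ZMod 89) * 67 = 7 := by decide
    have hns28 : ¬ IsSquare (-(28 : ZMod 89)) := by decide
    haveI : Fact (Nat.Prime 89) := ⟨hℓ⟩
    have hfac : ((t' : ZMod 89) - 28) * ((t' : ZMod 89) - 67) = 0 := by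
      linear_combination hroot - (t' : ZMod 89) * hr1 + hr2
    rcases mul_eq_zero.1 hfac with h1 | h1 <;> replace h1 := sub_eq_zero.1 h1
    · -- t' ≡ 28: -28 is a non-square mod 89 (that place is inert in E/F)
      rw [h1] at hsq; exact absurd hsq hns28
    · exact witness_transfer (u₀ := 47) (v₀ := 10) (g₀ := -9) (g₁ := -7) (t₀ := 67) hℓ (by norm_num)
        (by norm_num) (by norm_num) (by norm_num) (a₀ := -3) (a₁ := 0) (b₀ := 4) (b₁ := 1) (m₀ := -1) (m₁ := -1)
        (e := 1) (by norm_num) (by norm_num) (by norm_num) (by norm_num) hN hpos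
        (dvd_of_residue hN ht hγ 67 (by rw [h1]; norm_num))
  · -- ℓ = 97: roots 17, 86 of T² - 6T + 7
    subst h
    have hr1 : (17 : ZMod 97) + 86 = 6 := by decide
    have hr2 : (17 : ZMod 97) * 86 = 7 := by decide
    have hns17 : ¬ IsSquare (-(17 : ZMod 97)) := by decide
    haveI : Fact (Nat.Prime 97) := ⟨hℓ⟩
    have hfac : ((t' : ZMod 97) - 17) * ((t' : ZMod 97) - 86) = 0 := by
      linear_combination hroot - (t' : ZMod 97) * hr1 + hr2
    rcases mul_eq_zero.1 hfac with h1 | h1 <;> replace h1 := sub_eq_zero.1 h1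
    · -- t' ≡ 17: -17 is a non-square mod 97 (that place is inert in E/F)
      rw [h1] at hsq; exact absurd hsq hns17
    · exact witness_transfer (u₀ := 31) (v₀ := 6) (g₀ := -4) (g₁ := -5) (t₀ := 86) hℓ (by norm_num)
        (by norm_num) (by norm_num) (by norm_num) (a₀ := -4) (a₁ := -3) (b₀ := 1) (b₁ := 0) (m₀ := -11) (m₁ := -7)
        (e := 1) (by norm_num) (by norm_num) (by norm_num) (by norm_num) hN hpos
        (dvd_of_residue hN ht hγ 86 (by rw [h1]; norm_num))
  · -- ℓ = 103: roots 41, 68 of T² - 6T + 7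
    subst h
    have hr1 : (41 : ZMod 103) + 68 = 6 := by decide
    have hr2 : (41 : ZMod 103) * 68 = 7 := by decide
    have hns41 : ¬ IsSquare (-(41 : ZMod 103)) := by decide
    have hns68 : ¬ IsSquare (-(68 : ZMod 103)) := by decide
    haveI : Fact (Nat.Prime 103) := ⟨hℓ⟩
    have hfac : ((t' : ZMod 103) - 41) * ((t' : ZMod 103) - 68) = 0 := by
      linear_combination hroot - (t' : ZMod 103) * hr1 + hr2
    rcases mul_eq_zero.1 hfac with h1 | h1 <;> replace h1 := sub_eq_zero.1 h1
    · -- t' ≡ 41: -41 is a non-square mod 103 (that place is inert in E/F)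
      rw [h1] at hsq; exact absurd hsq hns41
    · -- t' ≡ 68: -68 is a non-square mod 103 (that place is inert in E/F)
      rw [h1] at hsq; exact absurd hsq hns68
  · -- ℓ = 113: roots 54, 65 of T² - 6T + 7
    subst h
    have hr1 : (54 : ZMod 113) + 65 = 6 := by decide
    have hr2 : (54 : ZMod 113) * 65 = 7 := by decide
    have hns54 : ¬ IsSquare (-(54 : ZMod 113)) := by decide
    have hns65 : ¬ IsSquare (-(65 : ZMod 113)) := by decide
    haveI : Fact (Nat.Prime 113) := ⟨hℓ⟩
    have hfac : ((t' : ZMod 113) - 54) * ((t' : ZMod 113) - 65) = 0 := by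
      linear_combination hroot - (t' : ZMod 113) * hr1 + hr2
    rcases mul_eq_zero.1 hfac with h1 | h1 <;> replace h1 := sub_eq_zero.1 h1
    · -- t' ≡ 54: -54 is a non-square mod 113 (that place is inert in E/F)
      rw [h1] at hsq; exact absurd hsq hns54
    · -- t' ≡ 65: -65 is a non-square mod 113 (that place is inert in E/F)
      rw [h1] at hsq; exact absurd hsq hns65
  · -- ℓ = 127: roots 19, 114 of T² - 6T + 7
    subst h
    have hr1 : (19 : ZMod 127) + 114 = 6 := by decide
    have hr2 : (19 : ZMod 127) * 114 = 7 := by decide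
    have hns19 : ¬ IsSquare (-(19 : ZMod 127)) := by decide
    haveI : Fact (Nat.Prime 127) := ⟨hℓ⟩
    have hfac : ((t' : ZMod 127) - 19) * ((t' : ZMod 127) - 114) = 0 := by
      linear_combination hroot - (t' : ZMod 127) * hr1 + hr2
    rcases mul_eq_zero.1 hfac with h1 | h1 <;> replace h1 := sub_eq_zero.1 h1
    · -- t' ≡ 19: -19 is a non-square mod 127 (that place is inert in E/F)
      rw [h1] at hsq; exact absurd hsq hns19
    · exact witness_transfer (u₀ := 36) (v₀ := 7) (g₀ := -5) (g₁ := -6) (t₀ := 114) hℓ (by norm_num)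
        (by norm_num) (by norm_num) (by norm_num) (a₀ := -2) (a₁ := 0) (b₀ := 2) (b₁ := 1) (m₀ := -3) (m₁ := -2)
        (e := 0) (by norm_num) (by norm_num) (by norm_num) (by norm_num) hN hpos
        (dvd_of_residue hN ht hγ 114 (by rw [h1]; norm_num))
  · -- ℓ = 137: roots 34, 109 of T² - 6T + 7
    subst h
    have hr1 : (34 : ZMod 137) + 109 = 6 := by decide
    have hr2 : (34 : ZMod 137) * 109 = 7 := by decide
    haveI : Fact (Nat.Prime 137) := ⟨hℓ⟩
    have hfac : ((t' : ZMod 137) - 34) * ((t' : ZMod 137) - 109) = 0 := by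
      linear_combination hroot - (t' : ZMod 137) * hr1 + hr2
    rcases mul_eq_zero.1 hfac with h1 | h1 <;> replace h1 := sub_eq_zero.1 h1
    · exact witness_transfer (u₀ := 65) (v₀ := 14) (g₀ := -4) (g₁ := -3) (t₀ := 34) hℓ (by norm_num)
        (by norm_num) (by norm_num) (by norm_num) (a₀ := -1) (a₁ := 0) (b₀ := 2) (b₁ := 0) (m₀ := -3) (m₁ := -2)
        (e := 0) (by norm_num) (by norm_num) (by norm_num) (by norm_num) hN hpos
        (dvd_of_residue hN ht hγ 34 (by rw [h1]; norm_num))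
    · exact witness_transfer (u₀ := 169) (v₀ := 38) (g₀ := -45) (g₁ := -29) (t₀ := 109) hℓ (by norm_num)
        (by norm_num) (by norm_num) (by norm_num) (a₀ := -3) (a₁ := -2) (b₀ := 3) (b₁ := 1) (m₀ := -19) (m₁ := -12)
        (e := 0) (by norm_num) (by norm_num) (by norm_num) (by norm_num) hN hpos
        (dvd_of_residue hN ht hγ 109 (by rw [h1]; norm_num))
  · -- ℓ = 151: roots 49, 108 of T² - 6T + 7
    subst h
    have hr1 : (49 : ZMod 151) + 108 = 6 := by decide
    have hr2 : (49 : ZMod 151) * 108 = 7 := by decide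
    have hns49 : ¬ IsSquare (-(49 : ZMod 151)) := by decide
    haveI : Fact (Nat.Prime 151) := ⟨hℓ⟩
    have hfac : ((t' : ZMod 151) - 49) * ((t' : ZMod 151) - 108) = 0 := by
      linear_combination hroot - (t' : ZMod 151) * hr1 + hr2
    rcases mul_eq_zero.1 hfac with h1 | h1 <;> replace h1 := sub_eq_zero.1 h1
    · -- t' ≡ 49: -49 is a non-square mod 151 (that place is inert in E/F)
      rw [h1] at hsq; exact absurd hsq hns49
    · exact witness_transfer (u₀ := 156) (v₀ := 35) (g₀ := -37) (g₁ := -24) (t₀ := 108) hℓ (by norm_num)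
        (by norm_num) (by norm_num) (by norm_num) (a₀ := -2) (a₁ := -2) (b₀ := 1) (b₁ := 0) (m₀ := -19) (m₁ := -12)
        (e := 0) (by norm_num) (by norm_num) (by norm_num) (by norm_num) hN hpos
        (dvd_of_residue hN ht hγ 108 (by rw [h1]; norm_num))
  · -- ℓ = 167: roots 16, 157 of T² - 6T + 7
    subst h
    have hr1 : (16 : ZMod 167) + 157 = 6 := by decide
    have hr2 : (16 : ZMod 167) * 157 = 7 := by decide
    have hns16 : ¬ IsSquare (-(16 : ZMod 167)) := by decide
    have hns157 : ¬ IsSquare (-(157 : ZMod 167)) := by decide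
    haveI : Fact (Nat.Prime 167) := ⟨hℓ⟩
    have hfac : ((t' : ZMod 167) - 16) * ((t' : ZMod 167) - 157) = 0 := by
      linear_combination hroot - (t' : ZMod 167) * hr1 + hr2
    rcases mul_eq_zero.1 hfac with h1 | h1 <;> replace h1 := sub_eq_zero.1 h1
    · -- t' ≡ 16: -16 is a non-square mod 167 (that place is inert in E/F)
      rw [h1] at hsq; exact absurd hsq hns16
    · -- t' ≡ 157: -157 is a non-square mod 167 (that place is inert in E/F)
      rw [h1] at hsq; exact absurd hsq hns157
  · -- composite values of ℓ ≡ ±1 (mod 8) below 182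
    rcases h with rfl | rfl | rfl | rfl | rfl | rfl | rfl | rfl | rfl | rfl | rfl | rfl | rfl | rfl | rfl | rfl | rfl | rfl | rfl | rfl | rfl | rfl | rfl | rfl | rfl | rfl | rfl | rfl <;> norm_num at hℓ

end Summit.HodgeConjecture.HodgeConjecture.Ring2.WeilCoverageCM

end
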